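import Summits.ResolutionOfSingularities.ResolutionOfSingularities.Theorems.DeltaCutRun2
import HarnessLib

/-!
# DeltaCutRun3 — decomp-res node «RunCut» (lens-6 g25, critic row 190 CLEARED +1), tree file 3/7 of the node

Content VERBATIM from the decomp-res lens-6 g25 node `HOME/decomp-res-lens-6/g25/RunCut.lean` (pin e4e94516; NEW
part l. 1187–2651; the node's carry of g24 l. 89–1165 dropped in favour of `import …DeltaCutChain3` /
`…DeltaCutChainCertificates2`); HOME = run/shared/lean/pub/decomp-res; critic row 190 CLEARED +1; landing plan
NEXT-g26.md bfe16773 §4 + rider INBOX :1047 — provenance, critic text and the lens header in full in the first file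
of the node, `DeltaCutRun`.  Namespace `…Theorems.DeltaCutClasses`; `--supports stmt-ResolutionOfSingularities-26971`.

## This file

Continuation 3/3 of `DeltaCutRun` (same sections of the node, cut at the 400-line cap): carries
`wor_of_runTerminatesAt`, `wor_of_runTerminates`, `worTopChainHeavyRunTame_of_five`,
`e1TopChainHeavyRunTame_of_five`, `e1TopChainHeavy_iff_e1TopRunHeavy`, `worTopChainHeavy_iff_worTopRunHeavy`,
`e1TopDeltaHeavy_iff_e1TopRunHeavy`, `worTopDeltaHeavy_iff_worTopRunHeavy`, `e1TopHeavy_iff_e1TopRunHeavy`,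
`e1TopNoAbs_iff_e1TopRunHeavy`, `e_one_iff_e1TopRunHeavy`, `badEmpty_hop_of_chainTame`,
`runTerminates_of_chainTame`, `runTerminates_of_not_topChainHeavy`, `topChainHeavy_of_not_runTerminates`,
`worTopRunHeavy_iff_intrinsic`, `not_runTerminates_iff_of_isBase`.

[WRITER NOTE (decomp-res writer g12): file split only (tree files ≤ 400 lines); namespace, sections, section opens
and every declaration exactly as in the lens (the carry block and the node's global dupNamespace-linter line are
dropped — the library sets the latter; the two namespace-level `open …TwistCutClasses` / `open …LightCutClasses`
lines of the node are replayed).]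

(Sources: Hironaka1967 (characteristic polyhedra); CossartJannsenSaito2020 Def. 3.13 / Thm. 3.14, Ch. 8, Thm. 9.6;
Hironaka1970 (near points / vertices); CossartPiltant2019 Prop. 2.6; CossartPiltant2008 §2; Giraud1975; Hironaka2005
(three key theorems: order under permissible blow-up); König 1927 (Kőnig's lemma) as Mathlib
`nonempty_sections_of_finite_inverse_system`; EGAIV4 §16–§17; StacksProject 0804 / 0BIQ / 031I; Matsumura1987 §28.)
-/

noncomputable section

open CategoryTheory CategoryTheory.Limits AlgebraicGeometry TopologicalSpace IsLocalRing
open Literature.AlgebraicGeometry.Resolution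

universe u

namespace Summit.ResolutionOfSingularities.ResolutionOfSingularities.Theorems.DeltaCutClasses

open Summit.ResolutionOfSingularities.ResolutionOfSingularities.Theorems.TwistCutClasses
open Summit.ResolutionOfSingularities.ResolutionOfSingularities.Theorems.LightCutClasses

section RunEngine

open Summit.ResolutionOfSingularities.ResolutionOfSingularities.Theorems
open WeakOrderReduction ForcedTowerClasses SubfieldContactClasses AbsoluteContactClasses PurityValveClasses
open Scheme.IdealSheafData (vanishingIdeal)

/-- **THE ENGINE ITERATED (one theorem for ALL heights).**  For every `h`: a base `n`-datum whose canonical bad run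
has FINITE bad
loci below level `h` and EMPTY bad locus at level `h` has a weak resolution, given `SeqDimFour 5 n` — by induction on `h`
generalising the stage.  `h = 0`: no bad point, so every wild closed top point is δ-light and g23's closing law
`wor_of_splitOrLightOrDeltaLight` applies.  `h + 1`: blow up the reduced finite bad locus (a regular centre inside
the top locus:
weakly admissible; base upstairs by `baseStable_holds`, `n`-datum upstairs by `isDatum_transform_blowup`); the run of the
transformed datum IS the tail of the run (`run_succ_front`, `hop_next_of_finite`), so the induction hypothesis
resolves it; splice
the centre in front (`CentreSeq.cons`). [new] [folklore] -/
theorem wor_of_runTerminatesAt {n : ℕ} (hn : 1 ≤ n) (h5 : SeqDimFour 5 n) (p : ℕ) (hp : p.Prime) (k : Type) [Field k]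
    [CharP k p] : ∀ (h : ℕ) (Y : Scheme.{0}) (g : Y ⟶ Spec (.of k)), IsBase Y g → ∀ M : MarkedIdeal Y, IsDatum n M →
      (∀ j < h, BadFinite n (run n ⟨Y, M.ideal⟩ j)) → BadEmpty n (run n ⟨Y, M.ideal⟩ h) →
        ∃ t : CentreSeq Y, WeakResolution t M := by
  intro h
  induction h with
  | zero =>
    intro Y g hB M hM _ hemp
    have hemp' : badLocus Y M.ideal n = ∅ := hemp
    refine wor_of_splitOrLightOrDeltaLight hn h5 p hp k Y g hB M hM fun y' hw => Or.inr ?_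
    by_contra hnd
    have hy' : y' ∈ badLocus Y M.ideal n := ⟨hw.1, hw.2.1, hw.2.2, hnd⟩
    rw [hemp'] at hy'
    exact hy'
  | succ h ih =>
    intro Y g hB M hM hpre hemp
    haveI : IsLocallyNoetherian Y := isLocallyNoetherian_of_isBase hB
    have hfin : BadFinite n ⟨Y, M.ideal⟩ := hpre 0 (Nat.succ_pos h)
    -- the centre: the reduced finite bad locus
    have hCreg : Scheme.IsRegular (badCentre n ⟨Y, M.ideal⟩ hfin).subscheme :=
      isRegular_subscheme_badCentre n ⟨Y, M.ideal⟩ hfin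
    have hCsupp : ((badCentre n ⟨Y, M.ideal⟩ hfin).support : Set Y) = badLocus Y M.ideal n :=
      coe_support_badCentre n ⟨Y, M.ideal⟩ hfin
    generalize hCdef : badCentre n ⟨Y, M.ideal⟩ hfin = C at hCreg hCsupp
    have hCsub : (C.support : Set Y) ⊆ M.support := by
      rw [hCsupp]; intro y hy
      show (M.mult : ℕ∞) ≤ idealOrder M.ideal y
      rw [hM.1, hy.2.1]
    have hB₁ : IsBase (blowup C) (blowup.π C ≫ g) := baseStable_holds k Y g hB C hCreg
    have hM₁ : IsDatum n (M.transform (blowup.π C) C) :=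
      isDatum_transform_blowup hB hM hCreg fun y hy => by
        have hy' : y ∈ (C.support : Set Y) := hy
        rw [hCsupp] at hy'
        exact hy'.2.1
    -- the stage identity: the hop of `(Y, 𝓘)` IS `(Bl_C Y, transformed ideal)`
    have hS₁ : (hop n ⟨Y, M.ideal⟩).next = ⟨blowup C, (M.transform (blowup.π C) C).ideal⟩ := by
      rw [hop_next_of_finite hfin, MarkedIdeal.transform_ideal, hM.1, hCdef]
    have hpre' : ∀ j < h, BadFinite n (run n ⟨blowup C, (M.transform (blowup.π C) C).ideal⟩ j) := fun j hj => by
      have := hpre (j + 1) (Nat.succ_lt_succ hj)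
      rwa [run_succ_front, hS₁] at this
    have hemp' : BadEmpty n (run n ⟨blowup C, (M.transform (blowup.π C) C).ideal⟩ h) := by
      have := hemp
      rwa [run_succ_front, hS₁] at this
    obtain ⟨t', ht'⟩ := ih (blowup C) (blowup.π C ≫ g) hB₁ (M.transform (blowup.π C) C) hM₁ hpre' hemp'
    exact ⟨CentreSeq.cons C t', ⟨hCsub, hCreg, ht'.1⟩, ht'.2⟩

/-- **THE ENGINE · the decided cell closes**: a base `n`-datum whose canonical bad run TERMINATES has a weak resolution, given
`SeqDimFour 5 n` (`= E 5` at `n`). [new] [folklore] -/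
theorem wor_of_runTerminates {n : ℕ} (hn : 1 ≤ n) (h5 : SeqDimFour 5 n) (p : ℕ) (hp : p.Prime) (k : Type) [Field k]
    [CharP k p] (Y : Scheme.{0}) (g : Y ⟶ Spec (.of k)) (hB : IsBase Y g) (M : MarkedIdeal Y) (hM : IsDatum n M)
    (hrun : RunTerminates n ⟨Y, M.ideal⟩) : ∃ t : CentreSeq Y, WeakResolution t M := by
  obtain ⟨h, hpre, hemp⟩ := hrun
  exact wor_of_runTerminatesAt hn h5 p hp k h Y g hB M hM hpre hemp

/-- **THE DECIDED CELL IS PROVED from `SeqDimFour 5 n`.** [new] [folklore] -/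
theorem worTopChainHeavyRunTame_of_five {n : ℕ} (hn : 1 ≤ n) (h5 : SeqDimFour 5 n) : WORTopChainHeavyRunTame n :=
  fun p hp k _ _ Y g hB M hM _ _ _ hrun => wor_of_runTerminates hn h5 p hp k Y g hB M hM hrun

/-- **THE DECIDED family is PROVED from `E 5`** (tree: `E 5` ⟸ CJS (R), `e_five_of_RCJS`). [new] [folklore] -/
theorem e1TopChainHeavyRunTame_of_five (h5 : E 5) : E1TopChainHeavyRunTame :=
  fun n hn => worTopChainHeavyRunTame_of_five hn (h5 n hn)

/-- **RE-LOCATION OF THE RESIDUAL (rule (C))**: under `E 5`, `E1TopChainHeavy ⟺ E1TopRunHeavy` — g24's located residual is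
EQUIVALENT to its strictly sharper typed sub-class «the canonical bad run does not terminate». [new] [folklore] -/
theorem e1TopChainHeavy_iff_e1TopRunHeavy (h5 : E 5) : E1TopChainHeavy ↔ E1TopRunHeavy :=
  ⟨fun h => (e1TopChainHeavy_iff_runHeavy_runTame.1 h).1,
    fun h => e1TopChainHeavy_iff_runHeavy_runTame.2 ⟨h, e1TopChainHeavyRunTame_of_five h5⟩⟩

/-- Per marking: under `SeqDimFour 5 n`, `WORTopChainHeavy n ⟺ WORTopRunHeavy n`. [new] [folklore] -/
theorem worTopChainHeavy_iff_worTopRunHeavy {n : ℕ} (hn : 1 ≤ n) (h5 : SeqDimFour 5 n) :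
    WORTopChainHeavy n ↔ WORTopRunHeavy n :=
  ⟨fun h => ((worTopChainHeavy_iff_runHeavy_runTame n).1 h).1,
    fun h => (worTopChainHeavy_iff_runHeavy_runTame n).2 ⟨h, worTopChainHeavyRunTame_of_five hn h5⟩⟩

/-- g23's booked residual: under `E 5`, `E1TopDeltaHeavy ⟺ E1TopRunHeavy` (g24 `e1TopDeltaHeavy_iff_e1TopChainHeavy`
∘ g25). [new] [folklore] -/
theorem e1TopDeltaHeavy_iff_e1TopRunHeavy (h5 : E 5) : E1TopDeltaHeavy ↔ E1TopRunHeavy :=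
  (e1TopDeltaHeavy_iff_e1TopChainHeavy h5).trans (e1TopChainHeavy_iff_e1TopRunHeavy h5)

/-- Per marking: under `SeqDimFour 5 n`, `WORTopDeltaHeavy n ⟺ WORTopRunHeavy n`. [new] [folklore] -/
theorem worTopDeltaHeavy_iff_worTopRunHeavy {n : ℕ} (hn : 1 ≤ n) (h5 : SeqDimFour 5 n) :
    WORTopDeltaHeavy n ↔ WORTopRunHeavy n :=
  (worTopDeltaHeavy_iff_worTopChainHeavy hn h5).trans (worTopChainHeavy_iff_worTopRunHeavy hn h5)

/-- **THE WHOLE COLUMN after g25**: under `E 5`, `E1TopHeavy ⟺ E1TopRunHeavy` (tree `e1TopHeavy_iff_e1TopDeltaHeavy`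
∘ g24 ∘ g25).
[new] [folklore] -/
theorem e1TopHeavy_iff_e1TopRunHeavy (h5 : E 5) : E1TopHeavy ↔ E1TopRunHeavy :=
  (e1TopHeavy_iff_e1TopChainHeavy h5).trans (e1TopChainHeavy_iff_e1TopRunHeavy h5)

/-- **DOWN-LINK TO ITEM 26971's CLASS** (tree `LightCutClasses.e1TopNoAbs_iff_e1TopHeavy` ∘ …): under `SubfieldContactAbs` and
`E 5`, `E1TopNoAbs ⟺ E1TopRunHeavy`. [new] [folklore] -/
theorem e1TopNoAbs_iff_e1TopRunHeavy (hSC : SubfieldContactAbs) (h5 : E 5) : E1TopNoAbs ↔ E1TopRunHeavy :=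
  (e1TopNoAbs_iff_e1TopChainHeavy hSC h5).trans (e1TopChainHeavy_iff_e1TopRunHeavy h5)

/-- **SUMMIT EDGE after g25** (tree `LightCutClasses.e_one_iff_e1TopHeavy` ∘ …): under `SubfieldContactAbs` and `E 5`,
`E 1 ⟺ E1TopRunHeavy` — the column's ONE open statement is the run residual. [new] [folklore] -/
theorem e_one_iff_e1TopRunHeavy (hSC : SubfieldContactAbs) (h5 : E 5) : E 1 ↔ E1TopRunHeavy :=
  (e_one_iff_e1TopChainHeavy hSC h5).trans (e1TopChainHeavy_iff_e1TopRunHeavy h5)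

end RunEngine

section RunExactness

open Summit.ResolutionOfSingularities.ResolutionOfSingularities.Theorems
open WeakOrderReduction ForcedTowerClasses SubfieldContactClasses AbsoluteContactClasses PurityValveClasses
open Scheme.IdealSheafData (vanishingIdeal)

/-! ### §RunExactness — the cut sits INSIDE g24 hyp-free; the residual read INTRINSICALLY -/

/-- **g24-DECIDED ⊆ RUN-DECIDED (hyp-free over a locally Noetherian stage)**: if the bad locus is FINITE and every bad point is
CHAIN-LIGHT, the bad locus after ONE hop is EMPTY.  Over a bad point `y₀`: split the centre `𝓘(bad) = 𝓘{y₀}·𝓘(bad ∖ y₀)`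
(`vanishingIdeal_sup_eq_mul_of_disjoint`) and read the chain letter through the split blow-up (g24
`deltaLightAt_of_chainLightAt_fac`): a bad point upstairs over `y₀` would be δ-light; bad points upstairs lie over bad points
(LEMMA A). [new] [folklore] -/
theorem badEmpty_hop_of_chainTame (n : ℕ) (N : Stage) [IsLocallyNoetherian N.Y] (hfin : BadFinite n N)
    (hcl : ∀ y ∈ badLocus N.Y N.I n, ChainLightAt N.I n y) : BadEmpty n (hop n N).next := by
  rw [BadEmpty, hop_next_of_finite hfin]
  refine Set.eq_empty_iff_forall_notMem.2 fun y' hy' => ?_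
  have hπ := blowup.isBlowup (badCentre n N hfin)
  have hyS : (blowup.π (badCentre n N hfin)).base y' ∈ badLocus N.Y N.I n := blowup_badCentre_base_mem n N hfin hy'
  have hy₀c : IsClosed ({(blowup.π (badCentre n N hfin)).base y'} : Set N.Y) := hyS.1
  have hS₂c : IsClosed (badLocus N.Y N.I n \ {(blowup.π (badCentre n N hfin)).base y'}) :=
    isClosed_of_finite_of_isClosed_singleton (hfin.subset fun _ hy => hy.1) fun y hy => hy.1.1
  have hy₀Z₂ : (blowup.π (badCentre n N hfin)).base y' ∉
      ((⟨badLocus N.Y N.I n \ {(blowup.π (badCentre n N hfin)).base y'}, hS₂c⟩ : Closeds N.Y) : Set N.Y) :=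
    fun h => h.2 rfl
  have hCmul : badCentre n N hfin = vanishingIdeal ⟨{(blowup.π (badCentre n N hfin)).base y'}, hy₀c⟩ *
      vanishingIdeal ⟨badLocus N.Y N.I n \ {(blowup.π (badCentre n N hfin)).base y'}, hS₂c⟩ := by
    rw [← vanishingIdeal_sup_eq_mul_of_disjoint (Set.disjoint_singleton_left.mpr hy₀Z₂)]
    unfold badCentre
    congr 1
    exact Closeds.ext (by
      rw [Closeds.coe_sup]
      exact (Set.union_sdiff_cancel (Set.singleton_subset_iff.2 hyS)).symm)
  have hct : controlledTransform (blowup.π (badCentre n N hfin)) (badCentre n N hfin) N.I n =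
      controlledTransform (blowup.π (badCentre n N hfin))
        (vanishingIdeal ⟨{(blowup.π (badCentre n N hfin)).base y'}, hy₀c⟩ *
          vanishingIdeal ⟨badLocus N.Y N.I n \ {(blowup.π (badCentre n N hfin)).base y'}, hS₂c⟩) N.I n :=
    congrArg (fun c => controlledTransform (blowup.π (badCentre n N hfin)) c N.I n) hCmul
  have hπ' : IsBlowup (blowup.π (badCentre n N hfin))
      (vanishingIdeal ⟨{(blowup.π (badCentre n N hfin)).base y'}, hy₀c⟩ *
        vanishingIdeal ⟨badLocus N.Y N.I n \ {(blowup.π (badCentre n N hfin)).base y'}, hS₂c⟩) := by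
    rw [← hCmul]; exact hπ
  obtain ⟨hy'c, hord, hna, hnd⟩ := hy'
  rw [hct] at hord hna hnd
  exact hnd (deltaLightAt_of_chainLightAt_fac hy₀c hy₀Z₂ hπ' (hcl _ hyS) rfl hy'c hord hna)

/-- hence such a run TERMINATES at height `≤ 1`. [new] [folklore] -/
theorem runTerminates_of_chainTame (n : ℕ) (N : Stage) [IsLocallyNoetherian N.Y] (hfin : BadFinite n N)
    (hcl : ∀ y ∈ badLocus N.Y N.I n, ChainLightAt N.I n y) : RunTerminates n N :=
  ⟨1, fun j hj => by
    obtain rfl : j = 0 := Nat.lt_one_iff.1 hj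
    exact hfin, badEmpty_hop_of_chainTame n N hfin hcl⟩

/-- **INCLUSION 1 (hyp-free): NOT chain-heavy ⟹ the canonical bad run TERMINATES** (g24's decided condition is contained in
g25's). [new] [folklore] -/
theorem runTerminates_of_not_topChainHeavy {Y : Scheme.{0}} [IsLocallyNoetherian Y] {I : Y.IdealSheafData} {n : ℕ}
    (h : ¬ TopChainHeavy Y I n) : RunTerminates n ⟨Y, I⟩ := by
  rw [TopChainHeavy, not_or, Set.not_infinite] at h
  haveI : IsLocallyNoetherian (⟨Y, I⟩ : Stage).Y := ‹IsLocallyNoetherian Y›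
  refine runTerminates_of_chainTame n ⟨Y, I⟩ h.1 fun y hy => ?_
  by_contra hc
  exact h.2 ⟨y, hy, hc⟩

/-- **INCLUSION 2 (hyp-free): the canonical bad run does NOT terminate ⟹ CHAIN-HEAVY** (g25's residual locus is contained in
g24's). [new] [folklore] -/
theorem topChainHeavy_of_not_runTerminates {Y : Scheme.{0}} [IsLocallyNoetherian Y] {I : Y.IdealSheafData} {n : ℕ}
    (h : ¬ RunTerminates n ⟨Y, I⟩) : TopChainHeavy Y I n :=
  not_not.1 fun hc => h (runTerminates_of_not_topChainHeavy hc)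

/-- **THE RESIDUAL CELL READ INTRINSICALLY**: `WORTopRunHeavy n ⟺ «every base `n`-datum whose canonical bad run does NOT
terminate has a weak resolution»` — the three located hypotheses `TopHeavy`, `TopDeltaHeavy`, `TopChainHeavy` are IMPLIED by
`¬ RunTerminates` (`topChainHeavy_of_not_runTerminates`, g24 `topDeltaHeavy_of_topChainHeavy`, g23
`topHeavy_of_topDeltaHeavy`). [new] [folklore] -/
theorem worTopRunHeavy_iff_intrinsic {n : ℕ} (hn : 1 ≤ n) :
    WORTopRunHeavy n ↔
      ∀ p : ℕ, p.Prime → ∀ (k : Type) [Field k] [CharP k p] (Y : Scheme.{0}) (g : Y ⟶ Spec (.of k)),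
        IsBase Y g → ∀ M : MarkedIdeal Y, IsDatum n M → ¬ RunTerminates n ⟨Y, M.ideal⟩ →
          ∃ t : CentreSeq Y, WeakResolution t M := by
  constructor
  · intro h p hp k _ _ Y g hB M hM hr
    haveI : IsLocallyNoetherian Y := isLocallyNoetherian_of_isBase hB
    have hC : TopChainHeavy Y M.ideal n := topChainHeavy_of_not_runTerminates hr
    have hD : TopDeltaHeavy Y M.ideal n := topDeltaHeavy_of_topChainHeavy hp hB hn hM hC
    exact h p hp k Y g hB M hM (topHeavy_of_topDeltaHeavy hD) hD hC hr
  · intro h p hp k _ _ Y g hB M hM _ _ _ hr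
    exact h p hp k Y g hB M hM hr

/-- **THE RESIDUAL LOCUS UNFOLDED EXACTLY over base data**: the canonical bad run of a base datum does not terminate iff it
reaches an INFINITE level or carries an INFINITE BAD THREAD with all levels finite. [new] [folklore] -/
theorem not_runTerminates_iff_of_isBase {k : Type} [Field k] {Y : Scheme.{0}} {g : Y ⟶ Spec (.of k)} (hB : IsBase Y g)
    (I : Y.IdealSheafData) (n : ℕ) :
    ¬ RunTerminates n ⟨Y, I⟩ ↔
      RunInfiniteLevel n ⟨Y, I⟩ ∨ ((∀ i, BadFinite n (run n ⟨Y, I⟩ i)) ∧ Nonempty (BadThread n ⟨Y, I⟩)) := by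
  haveI : IsLocallyNoetherian (⟨Y, I⟩ : Stage).Y := isLocallyNoetherian_of_isBase hB
  exact not_runTerminates_iff_infiniteLevel_or_thread n ⟨Y, I⟩

end RunExactness

end Summit.ResolutionOfSingularities.ResolutionOfSingularities.Theorems.DeltaCutClasses
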